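import Mathlib.Analysis.Calculus.MeanValue
import Mathlib.Analysis.SpecialFunctions.ExpDeriv
import Literature.Geometry.Lorentzian.InverseMeanCurvatureFlow
import HarnessLib

/-!
# Inverse mean curvature flow II: Geroch monotonicity in the smooth case, steps 2–3
(family `gr`; first proved layer towards the named fact
`Literature.Geometry.Lorentzian.geroch_monotonicity_smooth` of `InverseMeanCurvatureFlow.lean`)

Huisken–Ilmanen, J. Differential Geom. 59 (2001), §5, "Monotonicity Calculation", prove that the
Hawking mass `m_H(N_t) = |N_t|^{1/2} (16π - ∫_{N_t} H²) / (16π)^{3/2}` is nondecreasing along a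
smooth inverse mean curvature flow `(N_t)` of closed connected surfaces in a `3`-manifold with
`R ≥ 0` (Geroch 1973, Jang–Wald 1977) in three printed steps:

1. *the differential inequality* `d/dt ∫_{N_t} H² ≤ ½ (16π - ∫_{N_t} H²)` "provided that `N_t` is
   connected and `R ≥ 0`" (from (1.1), (1.3), the Gauss equation, the Gauss–Bonnet formula and an
   integration by parts on the closed surface `N_t`);
2. "*It follows that the quantity `e^{t/2} (16π - ∫_{N_t} H²)` is nondecreasing*";
3. "*Since `|N_t|^{1/2}` equals `e^{t/2}` up to a factor, this shows that `m_H(N_t)` is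
   nondecreasing*" (by the exponential growth of area (1.1), `|N_t| = e^t |N_0|`).

This file *proves* steps 2 and 3 for the classical solutions `IsClassicalIMCF` of
`InverseMeanCurvatureFlow.lean`, with `W(t) = ∫_{N_t} H² dμ_t` the real function
`IsClassicalIMCF.sqMeanCurvatureIntegral` (a definition):

* `monotoneOn_exp_half_mul_sub` — step 2 as pure calculus: if `W` is differentiable on `(a, b)`
  with `W' ≤ ½(16π - W)` then `e^{t/2}(16π - W(t))` is nondecreasing on `(a, b)` (its derivative
  is `e^{t/2}(½(16π - W) - W') ≥ 0`; mean value theorem);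
* `IsClassicalIMCF.hawkingMass_eq` — `m_H(N_t) = √(|N_t|/16π) (1 - W(t)/16π)`;
* `IsClassicalIMCF.hawkingMass_mono_of_monotoneOn` — step 3: for a classical solution whose
  areas satisfy (1.1), `|N_t| = e^{t-s}|N_s|`, and for which `e^{t/2}(16π - W(t))` is
  nondecreasing on `(a, b)`, `s ≤ t` implies `m_H(N_s) ≤ m_H(N_t)`;
* `IsClassicalIMCF.hawkingMass_mono` — steps 2–3: the same with the differential inequality of
  step 1 on `(a, b)` as hypothesis;
* `IsClassicalIMCF.hawkingMass_mono_of_area_exp` — the same with (1.1) supplied by the named fact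
  `area_exp_classical` of `InverseMeanCurvatureFlow.lean`.

What remains for `geroch_monotonicity_smooth` itself is exactly step 1 (the hypothesis `hW` of
`hawkingMass_mono`, for connected `N_t` and `R ≥ 0`) and the discharge of `area_exp_classical`;
both rest on the first variation of area, the evolution equation (1.3) of `H`, the Gauss equation,
the Gauss–Bonnet theorem with `χ(N_t) ≤ 2`, and the divergence theorem on closed surfaces, none
of which Mathlib has at present. No new named fact is introduced here.

## Mathlib

Used: `HasDerivAt` calculus (`HasDerivAt.exp`, `HasDerivAt.mul`), `monotoneOn_of_deriv_nonneg`
(mean value theorem), `ENNReal.toReal_mul`/`ENNReal.toReal_ofReal`, `Real.sqrt_mul`,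
`Real.sqrt_eq_iff_mul_self_eq_of_pos`. Mathlib has no mean curvature flow, Hawking mass or
Gauss–Bonnet theorem (see the module docstring of `InverseMeanCurvatureFlow.lean`).

## Design choices

* `W(t) = ∫_{N_t} H² dμ_t` is a total function of `t : ℝ` with junk value `0` outside the open
  interval `(a, b)` on which the classical solution lives; it is only evaluated, and
  differentiated, at points of the open set `(a, b)`, where the junk values are invisible.
* Step 1 enters `hawkingMass_mono` as the hypothesis `hW`: `W` is differentiable at every
  `t ∈ (a, b)` (`HasDerivAt`; in the smooth setting of §5 it is a smooth function of `t`, the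
  source writes `d/dt` without comment) with `W'(t) ≤ ½ (16π - W(t))` — the printed inequality.
  (1.1) enters as the hypothesis `harea`, literally the conclusion of `area_exp_classical` for the
  given solution. Neither connectedness of `S` nor `R ≥ 0` is needed for steps 2–3 (they enter
  only through step 1), so they are not assumed.

## References

* G. Huisken, T. Ilmanen, *The inverse mean curvature flow and the Riemannian Penrose
  inequality*, J. Differential Geom. 59 (2001) 353–437: §5, Monotonicity Calculation (smooth
  case), printed pp. 40–41; §1, (1.1).
* R. Geroch, *Energy extraction*, Ann. New York Acad. Sci. 224 (1973) 108–117.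
* P. S. Jang, R. M. Wald, *The positive energy conjecture and the cosmic censor hypothesis*,
  J. Math. Phys. 18 (1977) 41–44.
-/

noncomputable section

open Bundle Set Manifold TopologicalSpace Filter MeasureTheory
open scoped ContDiff Topology ENNReal Manifold Real

namespace Literature.Geometry.Lorentzian

open PseudoRiemannianMetric

variable {X : Type*} [TopologicalSpace X] [ChartedSpace E3 X] [IsManifold (𝓡 3) ∞ X]

/-! ### Step 2: the elementary calculus -/

/-- **Step 2 of the Monotonicity Calculation** (pure calculus): if `W : ℝ → ℝ` is differentiable
at every point of `(a, b)` with `W'(t) ≤ ½ (16π - W(t))`, then `t ↦ e^{t/2} (16π - W(t))` is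
nondecreasing on `(a, b)`; indeed its derivative is `e^{t/2} (½ (16π - W) - W') ≥ 0`.
Huisken–Ilmanen 2001, §5: "It follows that the quantity `e^{t/2}(16π - ∫_{N_t} H²)` is
nondecreasing." [cite: HuiskenIlmanenIMCF2001, §5 Monotonicity Calculation (smooth case), step "It follows that"] -/
theorem monotoneOn_exp_half_mul_sub {W : ℝ → ℝ} {a b : ℝ}
    (hW : ∀ t ∈ Set.Ioo a b, ∃ W' : ℝ, HasDerivAt W W' t ∧ W' ≤ 2⁻¹ * (16 * π - W t)) :
    MonotoneOn (fun t ↦ Real.exp (t / 2) * (16 * π - W t)) (Set.Ioo a b) := by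
  -- the derivative of `G t = e^{t/2} (16π - W t)` at the points of `(a, b)`
  have hG : ∀ t ∈ Set.Ioo a b, ∃ W' : ℝ, W' ≤ 2⁻¹ * (16 * π - W t) ∧
      HasDerivAt (fun t ↦ Real.exp (t / 2) * (16 * π - W t))
        (Real.exp (t / 2) * 2⁻¹ * (16 * π - W t) + Real.exp (t / 2) * (0 - W')) t := by
    intro t ht
    obtain ⟨W', hW', hle⟩ := hW t ht
    refine ⟨W', hle, ?_⟩
    have h1 : HasDerivAt (fun t : ℝ ↦ Real.exp (t / 2)) (Real.exp (t / 2) * 2⁻¹) t := by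
      have h := ((hasDerivAt_id t).div_const 2).exp
      simp only [id_eq, one_div] at h
      exact h
    have h2 : HasDerivAt (fun t : ℝ ↦ 16 * π - W t) (0 - W') t :=
      (hasDerivAt_const t (16 * π)).sub hW'
    exact h1.mul h2
  refine monotoneOn_of_deriv_nonneg (convex_Ioo a b) ?_ ?_ ?_
  · intro t ht
    obtain ⟨W', -, hd⟩ := hG t ht
    exact hd.continuousAt.continuousWithinAt
  · rw [interior_Ioo]
    intro t ht
    obtain ⟨W', -, hd⟩ := hG t ht
    exact hd.differentiableAt.differentiableWithinAt
  · rw [interior_Ioo]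
    intro t ht
    obtain ⟨W', hle, hd⟩ := hG t ht
    rw [hd.deriv]
    have hexp : 0 < Real.exp (t / 2) := Real.exp_pos _
    nlinarith [mul_nonneg hexp.le (sub_nonneg.2 hle)]

/-! ### The energy `W(t) = ∫_{N_t} H²` along a classical solution, and step 3 -/

section Classical

variable {h : ContMDiffRiemannianMetric (𝓡 3) ∞ E3 (TangentSpace (𝓡 3) : X → Type _)}
  [(ofRiemannian h).HasLeviCivita]
  {S : Type*} [TopologicalSpace S] [ChartedSpace (EuclideanSpace ℝ (Fin 2)) S]
  [IsManifold (𝓡 2) ∞ S] [CompactSpace S] [T2Space S] [MeasurableSpace S] [BorelSpace S]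
  {hpb : contMDiff_pullbackBilin (𝓡 3) X (𝓡 2) S ∞}
  {F : ℝ → S → X} {ν : (t : ℝ) → NormalField (𝓡 3) (F t)} {a b : ℝ}

/-- The **total squared mean curvature** `W(t) = ∫_{N_t} H² dμ_t` of the leaf `N_t = F_t(S)` of a
classical solution of the inverse mean curvature flow (`H` the mean curvature of `F t` w.r.t.
`ν t`, `dμ_t` the area measure `riemannianVolume (F_t^* h) 2` of the induced metric — exactly
the integral entering `hawkingMass`), as a function of `t : ℝ`; junk value `0` for `t ∉ (a, b)`.
Huisken–Ilmanen 2001, §5, Monotonicity Calculation (`∫_{N_t} H²`).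
[cite: HuiskenIlmanenIMCF2001, §5 Monotonicity Calculation (the quantity ∫_{N_t} H²)] -/
def IsClassicalIMCF.sqMeanCurvatureIntegral (H : IsClassicalIMCF h hpb F ν a b) (t : ℝ) : ℝ :=
  if ht : t ∈ Set.Ioo a b then
    ∫ y, (ofRiemannian h).meanCurvature (F t) hpb (H.isSpacelikeImmersion t ht) (ν t) y ^ 2
      ∂(riemannianVolume ((ofRiemannian h).inducedRiemannianMetric (F t) hpb
        (H.isSpacelikeImmersion t ht)) 2)
  else 0

/-- Unfolding lemma: for `t ∈ (a, b)`, `W(t) = ∫_{N_t} H² dμ_t`. [folklore] -/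
lemma IsClassicalIMCF.sqMeanCurvatureIntegral_of_mem (H : IsClassicalIMCF h hpb F ν a b) {t : ℝ}
    (ht : t ∈ Set.Ioo a b) :
    H.sqMeanCurvatureIntegral t =
      ∫ y, (ofRiemannian h).meanCurvature (F t) hpb (H.isSpacelikeImmersion t ht) (ν t) y ^ 2
        ∂(riemannianVolume ((ofRiemannian h).inducedRiemannianMetric (F t) hpb
          (H.isSpacelikeImmersion t ht)) 2) := by
  simp only [IsClassicalIMCF.sqMeanCurvatureIntegral, dif_pos ht]

/-- Unfolding lemma: the junk value `W(t) = 0` for `t ∉ (a, b)`. [folklore] -/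
lemma IsClassicalIMCF.sqMeanCurvatureIntegral_of_not_mem (H : IsClassicalIMCF h hpb F ν a b)
    {t : ℝ} (ht : t ∉ Set.Ioo a b) : H.sqMeanCurvatureIntegral t = 0 := by
  simp only [IsClassicalIMCF.sqMeanCurvatureIntegral, dif_neg ht]

/-- `W(t) ≥ 0` (an integral of squares, or the junk value `0`). [folklore] -/
lemma IsClassicalIMCF.sqMeanCurvatureIntegral_nonneg (H : IsClassicalIMCF h hpb F ν a b) (t : ℝ) :
    0 ≤ H.sqMeanCurvatureIntegral t := by
  by_cases ht : t ∈ Set.Ioo a b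
  · rw [H.sqMeanCurvatureIntegral_of_mem ht]
    exact integral_nonneg fun _ ↦ sq_nonneg _
  · rw [H.sqMeanCurvatureIntegral_of_not_mem ht]

/-- **The Hawking mass along the flow in terms of `W`**: for `t ∈ (a, b)`,
`m_H(N_t) = √(|N_t|/16π) · (1 - W(t)/16π)` (definition `hawkingMass` with `∫ H² = W(t)`), i.e.
Huisken–Ilmanen's `|N_t|^{1/2}(16π - ∫_{N_t}H²)/(16π)^{3/2}`. Huisken–Ilmanen 2001, §5 (definition
of `m_H` recalled before the Monotonicity Calculation). [cite: HuiskenIlmanenIMCF2001, §5 (definition of m_H)] -/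
theorem IsClassicalIMCF.hawkingMass_eq (H : IsClassicalIMCF h hpb F ν a b) {t : ℝ}
    (ht : t ∈ Set.Ioo a b) :
    hawkingMass h (F t) (ν t) hpb (H.isSpacelikeImmersion t ht) =
      Real.sqrt ((totalArea ((ofRiemannian h).inducedRiemannianMetric (F t) hpb
          (H.isSpacelikeImmersion t ht))).toReal / (16 * π)) *
        (1 - (16 * π)⁻¹ * H.sqMeanCurvatureIntegral t) := by
  rw [hawkingMass, H.sqMeanCurvatureIntegral_of_mem ht]

/-- **Step 3 of Huisken–Ilmanen's Monotonicity Calculation** ("Since `|N_t|^{1/2}` equals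
`e^{t/2}` up to a factor, this shows that `m_H(N_t)` is nondecreasing"). Let `(F, ν)` be a
classical solution of the inverse mean curvature flow on `(a, b)` by a compact surface `S` in the
Riemannian `3`-manifold `(X, h)`. Assume (1.1): `|N_t| = e^{t-s} |N_s|` for `s, t ∈ (a, b)`
(hypothesis `harea`, the conclusion of the named fact `area_exp_classical` for this solution), and
the conclusion of step 2: `t ↦ e^{t/2} (16π - W(t))` is nondecreasing on `(a, b)` (hypothesis
`hG`). Then `m_H(N_s) ≤ m_H(N_t)` for `s ≤ t` in `(a, b)`: dividing
`e^{s/2}(16π - W(s)) ≤ e^{t/2}(16π - W(t))` by `(16π)^{3/2} e^{s/2} > 0` and multiplying by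
`|N_s|^{1/2} ≥ 0`, with `|N_t|^{1/2} = e^{(t-s)/2} |N_s|^{1/2}`, gives
`m_H(N_s) = |N_s|^{1/2}(16π - W(s))/(16π)^{3/2} ≤ |N_t|^{1/2}(16π - W(t))/(16π)^{3/2} = m_H(N_t)`.
[cite: HuiskenIlmanenIMCF2001, §5 Monotonicity Calculation (smooth case), step 3 (last sentence)] -/
theorem IsClassicalIMCF.hawkingMass_mono_of_monotoneOn (H : IsClassicalIMCF h hpb F ν a b)
    (harea : ∀ ⦃s t : ℝ⦄ (hs : s ∈ Set.Ioo a b) (ht : t ∈ Set.Ioo a b),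
      totalArea ((ofRiemannian h).inducedRiemannianMetric (F t) hpb
          (H.isSpacelikeImmersion t ht)) =
        ENNReal.ofReal (Real.exp (t - s)) *
          totalArea ((ofRiemannian h).inducedRiemannianMetric (F s) hpb
            (H.isSpacelikeImmersion s hs)))
    (hG : MonotoneOn (fun t ↦ Real.exp (t / 2) * (16 * π - H.sqMeanCurvatureIntegral t))
      (Set.Ioo a b))
    ⦃s t : ℝ⦄ (hs : s ∈ Set.Ioo a b) (ht : t ∈ Set.Ioo a b) (hst : s ≤ t) :
    hawkingMass h (F s) (ν s) hpb (H.isSpacelikeImmersion s hs) ≤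
      hawkingMass h (F t) (ν t) hpb (H.isSpacelikeImmersion t ht) := by
  -- step 2: `e^{s/2}(16π - W s) ≤ e^{t/2}(16π - W t)`
  have hmono := hG hs ht hst
  simp only at hmono
  -- (1.1): `|N_t| = e^{t-s} |N_s|`
  have hA : (totalArea ((ofRiemannian h).inducedRiemannianMetric (F t) hpb
      (H.isSpacelikeImmersion t ht))).toReal =
        Real.exp (t - s) * (totalArea ((ofRiemannian h).inducedRiemannianMetric (F s) hpb
          (H.isSpacelikeImmersion s hs))).toReal := by
    rw [harea hs ht, ENNReal.toReal_mul, ENNReal.toReal_ofReal (Real.exp_pos _).le]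
  rw [H.hawkingMass_eq hs, H.hawkingMass_eq ht, hA]
  set W := H.sqMeanCurvatureIntegral with hWdef
  set A := (totalArea ((ofRiemannian h).inducedRiemannianMetric (F s) hpb
    (H.isSpacelikeImmersion s hs))).toReal with hAdef
  have hπ : 0 < 16 * π := by positivity
  -- `√(e^{t-s} A / 16π) = e^{(t-s)/2} √(A / 16π)`
  have hsqrt : Real.sqrt (Real.exp (t - s) * A / (16 * π)) =
      Real.exp ((t - s) / 2) * Real.sqrt (A / (16 * π)) := by
    have hexp : Real.sqrt (Real.exp (t - s)) = Real.exp ((t - s) / 2) := by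
      rw [Real.sqrt_eq_iff_mul_self_eq_of_pos (Real.exp_pos _), ← Real.exp_add]
      ring_nf
    rw [mul_div_assoc, Real.sqrt_mul (Real.exp_pos _).le, hexp]
  -- from step 2: `16π - W s ≤ e^{(t-s)/2} (16π - W t)`
  have hkey : 16 * π - W s ≤ Real.exp ((t - s) / 2) * (16 * π - W t) := by
    have hts : Real.exp (t / 2) = Real.exp (s / 2) * Real.exp ((t - s) / 2) := by
      rw [← Real.exp_add]
      ring_nf
    rw [hts, mul_assoc] at hmono
    exact le_of_mul_le_mul_left hmono (Real.exp_pos _)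
  have hkey' : 1 - (16 * π)⁻¹ * W s ≤ Real.exp ((t - s) / 2) * (1 - (16 * π)⁻¹ * W t) := by
    have h1 : 1 - (16 * π)⁻¹ * W s = (16 * π)⁻¹ * (16 * π - W s) := by
      field_simp
    have h2 : Real.exp ((t - s) / 2) * (1 - (16 * π)⁻¹ * W t) =
        (16 * π)⁻¹ * (Real.exp ((t - s) / 2) * (16 * π - W t)) := by
      field_simp
    rw [h1, h2]
    exact mul_le_mul_of_nonneg_left hkey (inv_nonneg.2 hπ.le)
  calc Real.sqrt (A / (16 * π)) * (1 - (16 * π)⁻¹ * W s)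
      ≤ Real.sqrt (A / (16 * π)) * (Real.exp ((t - s) / 2) * (1 - (16 * π)⁻¹ * W t)) :=
        mul_le_mul_of_nonneg_left hkey' (Real.sqrt_nonneg _)
    _ = Real.sqrt (Real.exp (t - s) * A / (16 * π)) * (1 - (16 * π)⁻¹ * W t) := by
        rw [hsqrt]
        ring

/-- **Geroch monotonicity in the smooth case, steps 2–3 of Huisken–Ilmanen's Monotonicity
Calculation.** Let `(F, ν)` be a classical solution of the inverse mean curvature flow on
`(a, b)` by a compact surface `S` in the Riemannian `3`-manifold `(X, h)`. Assume (1.1):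
`|N_t| = e^{t-s} |N_s|` for `s, t ∈ (a, b)` (hypothesis `harea`, the conclusion of the named fact
`area_exp_classical` for this solution), and step 1: `W(t) = ∫_{N_t} H²` is differentiable at
every `t ∈ (a, b)` with `W'(t) ≤ ½ (16π - W(t))` (hypothesis `hW`; Huisken–Ilmanen derive it for
connected `N_t` and `R ≥ 0` from (1.1), (1.3), the Gauss equation and Gauss–Bonnet). Then
`m_H(N_s) ≤ m_H(N_t)` for `s ≤ t` in `(a, b)`: step 2 (`monotoneOn_exp_half_mul_sub`) gives
`e^{s/2}(16π - W(s)) ≤ e^{t/2}(16π - W(t))`, and step 3 is `hawkingMass_mono_of_monotoneOn`.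
[cite: HuiskenIlmanenIMCF2001, §5 Monotonicity Calculation (smooth case), steps 2–3] -/
theorem IsClassicalIMCF.hawkingMass_mono (H : IsClassicalIMCF h hpb F ν a b)
    (harea : ∀ ⦃s t : ℝ⦄ (hs : s ∈ Set.Ioo a b) (ht : t ∈ Set.Ioo a b),
      totalArea ((ofRiemannian h).inducedRiemannianMetric (F t) hpb
          (H.isSpacelikeImmersion t ht)) =
        ENNReal.ofReal (Real.exp (t - s)) *
          totalArea ((ofRiemannian h).inducedRiemannianMetric (F s) hpb
            (H.isSpacelikeImmersion s hs)))
    (hW : ∀ t ∈ Set.Ioo a b, ∃ W' : ℝ, HasDerivAt H.sqMeanCurvatureIntegral W' t ∧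
      W' ≤ 2⁻¹ * (16 * π - H.sqMeanCurvatureIntegral t))
    ⦃s t : ℝ⦄ (hs : s ∈ Set.Ioo a b) (ht : t ∈ Set.Ioo a b) (hst : s ≤ t) :
    hawkingMass h (F s) (ν s) hpb (H.isSpacelikeImmersion s hs) ≤
      hawkingMass h (F t) (ν t) hpb (H.isSpacelikeImmersion t ht) :=
  H.hawkingMass_mono_of_monotoneOn harea (monotoneOn_exp_half_mul_sub hW) hs ht hst

end Classical

/-- **Steps 2–3 with (1.1) taken from the named fact `area_exp_classical`.** Given
`area_exp_classical` (Huisken–Ilmanen (1.1): `|N_t| = e^{t-s}|N_s|` for classical solutions by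
compact surfaces), a classical solution by a compact surface `S` in `(X, h)` whose energy
`W(t) = ∫_{N_t} H²` satisfies the differential inequality of step 1 on `(a, b)` has nondecreasing
Hawking mass on `(a, b)`. With step 1 (for connected `N_t` and `R ≥ 0`) this is exactly the
named fact `geroch_monotonicity_smooth`. Huisken–Ilmanen 2001, §5, Monotonicity Calculation,
last two sentences of the smooth case. [cite: HuiskenIlmanenIMCF2001, §5 Monotonicity Calculation (smooth case), steps 2–3] -/
theorem IsClassicalIMCF.hawkingMass_mono_of_area_exp (harea : area_exp_classical)
    {X : Type} [TopologicalSpace X] [ChartedSpace E3 X] [IsManifold (𝓡 3) ∞ X] [T2Space X]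
    [SecondCountableTopology X]
    {h : ContMDiffRiemannianMetric (𝓡 3) ∞ E3 (TangentSpace (𝓡 3) : X → Type _)}
    [(ofRiemannian h).HasLeviCivita]
    {S : Type} [TopologicalSpace S] [ChartedSpace (EuclideanSpace ℝ (Fin 2)) S]
    [IsManifold (𝓡 2) ∞ S] [CompactSpace S] [T2Space S] [MeasurableSpace S] [BorelSpace S]
    {hpb : contMDiff_pullbackBilin (𝓡 3) X (𝓡 2) S ∞}
    {F : ℝ → S → X} {ν : (t : ℝ) → NormalField (𝓡 3) (F t)} {a b : ℝ}
    (H : IsClassicalIMCF h hpb F ν a b)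
    (hW : ∀ t ∈ Set.Ioo a b, ∃ W' : ℝ, HasDerivAt H.sqMeanCurvatureIntegral W' t ∧
      W' ≤ 2⁻¹ * (16 * π - H.sqMeanCurvatureIntegral t))
    ⦃s t : ℝ⦄ (hs : s ∈ Set.Ioo a b) (ht : t ∈ Set.Ioo a b) (hst : s ≤ t) :
    hawkingMass h (F s) (ν s) hpb (H.isSpacelikeImmersion s hs) ≤
      hawkingMass h (F t) (ν t) hpb (H.isSpacelikeImmersion t ht) :=
  H.hawkingMass_mono (harea X h S hpb F ν a b H) hW hs ht hst

end Literature.Geometry.Lorentzian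

end
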